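import Summits.Ventures.LatticeQCDFlow.Exactness.HeatBathSweepCompact
import Summits.Ventures.LatticeQCDFlow.Exactness.DoeblinUniqueness
import Literature.MathematicalPhysics.QuantumFieldTheory.ConstructiveQFTWave0
import Literature.MathematicalPhysics.QuantumLattice.HeatKernelGroupMeasureProofs
import HarnessLib

/-!
# The heat-bath link sweep converges to the torus Wilson measure from every start

HONEST FRAMING: exact (Metropolis-corrected) sampling algorithms for lattice gauge theory;
figures of merit are autocorrelation/cost numbers at stated couplings and volumes; no
continuum-physics claim.

Venture `LatticeQCDFlow` (cell pub-lqcd), topic `Exactness`, FANOUT row 9 (eng-latcore, the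
engine `latflow.core`).  NEW WORK of the cell: the ENGINE INSTANCE of row 9's heat-bath
ergodicity theorems (`HeatBathSweepErgodic.lean`, `HeatBathSweepCompact.lean`) for the
Literature's finite-volume Wilson lattice gauge theory
(`Literature.MathematicalPhysics.QuantumFieldTheory.wilsonMeasure`, file
`ConstructiveQFTWave0.lean`: `μ_{Λ,β} = Z⁻¹ e^{−β S_W} ∏ₑ dHaar(U_e)` on `GaugeConfig d L G =
Edge d L → G`, torus `(ℤ/L)^d`, any compact group `G` with a continuous matrix representation
`ρ`).  Nothing is cited as a fact; the Literature definitions are used, not restated.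

## What is proved (`G` compact, second countable, Borel; `ρ` continuous; `L ≠ 0`)

* **`continuous_smul_wilsonAction`** — `U ↦ β·S_W(U)` is a continuous function of the
  configuration (plaquette holonomies are continuous: `Literature.MathematicalPhysics.QuantumLattice.
  continuous_plaquetteHolonomy`, `HeatKernelGroupMeasureProofs.lean`).
* **`wilsonMeasure_eq_piGibbsLaw`** — the Literature's torus Wilson measure IS row 9's normalised
  Gibbs law `piGibbsLaw (fun _ => haarProbability G) (gibbsDensity (β · S_W))` of the product Haar
  reference: the two vocabularies agree definitionally up to `Z = ∫ e^{−βS_W}`.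
* **`wilson_heatBathSweep_uniformlyErgodic`** — the single-LINK heat-bath scan over any list of
  edges visiting every edge (the engine's `updates.sweep(f, β, 'hb')` for `G = SU(2)` / `U(1)`; any
  site order, chequerboard or serial) converges to `wilsonMeasure ρ β` from EVERY initial law:
  there is an explicit `ε ∈ (0, 1]` with `|μ₀Kᵗ(A) − μ_{Λ,β}(A)| ≤ (1 − ε)ᵗ` for all `t`, `A`;
  **`wilson_heatBathSweep_comp_uniformlyErgodic`** — the same for the sweep followed by any exact
  Markov kernel (the `n_or` over-relaxation sweeps of `composite_sweep`).
* **`wilsonMeasure_unique_invariant`** — the torus Wilson measure is the ONLY probability law left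
  invariant by the heat-bath link sweep (via `DoeblinUniqueness.lean`).

For every `d`, `L`, `β`, compact `G`: a qualitative certificate (the constant is
`e^{−(sup βS_W − inf βS_W)·|l|}`), not an autocorrelation figure.  NOT CLAIMED: SU(N ≥ 3) via
Cabibbo–Marinari (the theorem is about the TRUE link heat bath, which the engine uses for
SU(2)/U(1)), HMC, any useful rate.
-/

namespace Summit.Ventures.LatticeQCDFlow.Exactness

open MeasureTheory ProbabilityTheory
open Literature.MathematicalPhysics.QuantumFieldTheory
open scoped ENNReal

section Wilson

variable {d L N : ℕ} {G : Type*} [Group G] [TopologicalSpace G] [IsTopologicalGroup G]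
  (ρ : G →* Matrix (Fin N) (Fin N) ℂ)

/-- **The scaled Wilson action `U ↦ β · S_W(U)` is continuous** (for a continuous representation):
a finite sum of real parts of traces of `ρ` of plaquette holonomies, each continuous
(`Literature.MathematicalPhysics.QuantumLattice.continuous_plaquetteHolonomy`).  (Continuity of
`S_W` itself is stated in another summit, `Summit.QuantumFields.QCD.Theorems.TiltedFlatnessNegative.
continuous_wilsonAction`, and belongs in Literature; only the scaled form used below is stated here.) -/
theorem continuous_smul_wilsonAction [NeZero L] (hρ : Continuous ρ) (β : ℝ) :
    Continuous fun U : GaugeConfig d L G => β * wilsonAction ρ U := by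
  refine continuous_const.mul ?_
  unfold wilsonAction
  refine continuous_finsetSum _ fun p _ => continuous_const.sub ?_
  exact Complex.continuous_re.comp ((continuous_id.matrix_trace).comp
    (hρ.comp (Literature.MathematicalPhysics.QuantumLattice.continuous_plaquetteHolonomy
      p.1 p.2.1.1 p.2.1.2)))

variable [CompactSpace G] [MeasurableSpace G] [BorelSpace G]

/-- **The torus Wilson measure is the normalised Gibbs law of the product Haar reference** with
density `e^{−β S_W}` — the Literature's `wilsonMeasure` and row 9's `piGibbsLaw` coincide. -/
theorem wilsonMeasure_eq_piGibbsLaw [NeZero L] (β : ℝ) :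
    wilsonMeasure (d := d) (L := L) ρ β =
      piGibbsLaw (fun _ : Edge d L => haarProbability G)
        (gibbsDensity fun U : GaugeConfig d L G => β * wilsonAction ρ U) := by
  have hdens : (fun U : GaugeConfig d L G => ENNReal.ofReal (Real.exp (-β * wilsonAction ρ U))) =
      gibbsDensity fun U : GaugeConfig d L G => β * wilsonAction ρ U := by
    funext U
    rw [gibbsDensity, neg_mul]
  rw [wilsonMeasure, partitionFunction, wilsonWeight, piGibbsLaw, hdens, withDensity_apply _ MeasurableSet.univ,
    Measure.restrict_univ]

variable [SecondCountableTopology G]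

/-- **The heat-bath link sweep converges to the Wilson measure from every start.**  For the torus
Wilson theory with a continuous representation, every scan of single-link heat baths visiting every
edge satisfies, for an explicit `ε ∈ (0,1]`: `|μ₀Kᵗ(A) − μ_{Λ,β}(A)| ≤ (1 − ε)ᵗ` for every initial
law `μ₀`, every `t`, every set `A`. -/
theorem wilson_heatBathSweep_uniformlyErgodic [NeZero L] (hρ : Continuous ρ) (β : ℝ)
    {l : List (Edge d L)} (hl : ∀ e, e ∈ l) :
    ∃ ε : ℝ, 0 < ε ∧ ε ≤ 1 ∧ ∀ (μ₀ : Measure (GaugeConfig d L G)) [IsProbabilityMeasure μ₀] (t : ℕ)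
      (A : Set (GaugeConfig d L G)),
      |((fun ν : Measure (GaugeConfig d L G) => ν.bind (cycle (l.map (siteHeatBath
          (fun _ : Edge d L => haarProbability G)
          (gibbsDensity fun U : GaugeConfig d L G => β * wilsonAction ρ U)))))^[t] μ₀).real A
          - (wilsonMeasure ρ β).real A| ≤ (1 - ε) ^ t := by
  rw [wilsonMeasure_eq_piGibbsLaw]
  exact heatBathSweep_uniformlyErgodic_of_continuous (μ := fun _ : Edge d L => haarProbability G)
    (continuous_smul_wilsonAction ρ hρ β) hl

/-- **… and so does the composite sweep** (heat-bath sweep followed by any exact Markov kernel,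
e.g. the over-relaxation sweeps). -/
theorem wilson_heatBathSweep_comp_uniformlyErgodic [NeZero L] (hρ : Continuous ρ) (β : ℝ)
    {l : List (Edge d L)} (hl : ∀ e, e ∈ l) (η : Kernel (GaugeConfig d L G) (GaugeConfig d L G))
    [IsMarkovKernel η] (hη : Kernel.Invariant η (wilsonWeight (d := d) (L := L) ρ β)) :
    ∃ ε : ℝ, 0 < ε ∧ ε ≤ 1 ∧ ∀ (μ₀ : Measure (GaugeConfig d L G)) [IsProbabilityMeasure μ₀] (t : ℕ)
      (A : Set (GaugeConfig d L G)),
      |((fun ν : Measure (GaugeConfig d L G) => ν.bind (η ∘ₖ cycle (l.map (siteHeatBath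
          (fun _ : Edge d L => haarProbability G)
          (gibbsDensity fun U : GaugeConfig d L G => β * wilsonAction ρ U)))))^[t] μ₀).real A
          - (wilsonMeasure ρ β).real A| ≤ (1 - ε) ^ t := by
  have hdens : (fun U : GaugeConfig d L G => ENNReal.ofReal (Real.exp (-β * wilsonAction ρ U))) =
      gibbsDensity fun U : GaugeConfig d L G => β * wilsonAction ρ U := by
    funext U
    rw [gibbsDensity, neg_mul]
  have hη' : Kernel.Invariant η ((Measure.pi fun _ : Edge d L => haarProbability G).withDensity
      (gibbsDensity fun U : GaugeConfig d L G => β * wilsonAction ρ U)) := by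
    rw [← hdens]; exact hη
  rw [wilsonMeasure_eq_piGibbsLaw]
  exact heatBathSweep_comp_uniformlyErgodic_of_continuous (μ := fun _ : Edge d L => haarProbability G)
    (continuous_smul_wilsonAction ρ hρ β) hl η hη'

/-- **The Wilson measure is the unique invariant probability law of the heat-bath link sweep.** -/
theorem wilsonMeasure_unique_invariant [NeZero L] (hρ : Continuous ρ) (β : ℝ) {l : List (Edge d L)}
    (hl : ∀ e, e ∈ l) {π' : Measure (GaugeConfig d L G)} [IsProbabilityMeasure π']
    (hπ' : Kernel.Invariant (cycle (l.map (siteHeatBath (fun _ : Edge d L => haarProbability G)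
      (gibbsDensity fun U : GaugeConfig d L G => β * wilsonAction ρ U)))) π') :
    π' = wilsonMeasure ρ β := by
  -- bounds on the continuous action over the compact configuration space
  have hS : Continuous fun U : GaugeConfig d L G => β * wilsonAction ρ U :=
    continuous_smul_wilsonAction ρ hρ β
  obtain ⟨ωa, -, hmin⟩ := isCompact_univ.exists_isMinOn Set.univ_nonempty hS.continuousOn
  obtain ⟨ωb, -, hmax⟩ := isCompact_univ.exists_isMaxOn Set.univ_nonempty hS.continuousOn
  have hωa : ∀ U, β * wilsonAction ρ ωa ≤ β * wilsonAction ρ U := fun U => (isMinOn_iff.1 hmin) U (Set.mem_univ U)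
  have hωb : ∀ U, β * wilsonAction ρ U ≤ β * wilsonAction ρ ωb := fun U => (isMaxOn_iff.1 hmax) U (Set.mem_univ U)
  rw [wilsonMeasure_eq_piGibbsLaw]
  exact heatBathSweep_invariant_unique (μ := fun _ : Edge d L => haarProbability G)
    (measurable_gibbsDensity hS) (m := ENNReal.ofReal (Real.exp (-(β * wilsonAction ρ ωb))))
    (M := ENNReal.ofReal (Real.exp (-(β * wilsonAction ρ ωa))))
    (by rw [Ne, ENNReal.ofReal_eq_zero, not_le]; exact Real.exp_pos _) ENNReal.ofReal_ne_top
    (fun U => (gibbsDensity_bounds hωa hωb U).1) (fun U => (gibbsDensity_bounds hωa hωb U).2) hl hπ'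

end Wilson

end Summit.Ventures.LatticeQCDFlow.Exactness
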